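import Summits.RiemannHypothesis.RiemannHypothesis.Theses.RuelleBand
import Literature.NumberTheory.LFunctions.GeneralizedRH
import Literature.NumberTheory.LFunctions.RHWave0HardyProofs

/-!
# `ExactFirstBand` (crux stmt-RiemannHypothesis-2061, route RuelleBand) — load-bearing analysis

Negative-side support file of the crux disprover (cdisprove seat, cycle 1). The crux is
`ExactFirstBand := ∀ s : ℂ, riemannZeta s = 0 → 0 < s.re → s.re < 1 → s.re = 1 / 2 ∨ s.im = 0`.
Which of its four syntactic ingredients (three hypotheses, one two-way disjunction) carry weight:

* `exactFirstBand_false_without_zeta` — dropping `riemannZeta s = 0` ⇒ FALSE (witness `1/4 + i`; sanity).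
* `exactFirstBand_iff_without_pos` — dropping `0 < s.re` ⇒ EQUIVALENT: the zeros with `re s ≤ 0` are the trivial
  zeros, which are real and absorbed by the disjunct `s.im = 0`.
* `exactFirstBand_iff_without_ltOne` — dropping `s.re < 1` ⇒ EQUIVALENT (no zeros on `re s ≥ 1`, Mathlib
  `riemannZeta_ne_zero_of_one_le_re` — the Euler product).
* `exactFirstBand_iff_allZeros` — dropping BOTH ⇒ EQUIVALENT: X is "every zero of Mathlib's `riemannZeta` is
  critical or real"; `exactFirstBand_iff_rightZerosReal` — ⇔ "every zero with `re s > 1/2` is real".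
* `not_allStripZerosReal` — dropping the disjunct `s.re = 1/2` ⇒ FALSE (Hardy: a zero `1/2 + it`, `t ≠ 0`,
  exists; in tree, proved); dropping `s.im = 0` ⇒ `RiemannHypothesisStrip`, EQUIVALENT (see `Reformulations`).
* `not_exactFirstBand_at_other_line` — TIGHTNESS: with `1/2` replaced by any `σ₀ ≠ 1/2` the statement is FALSE.
So the only load-bearing hypothesis is `riemannZeta s = 0`: all the content is the arithmetic of `ζ`.
-/

noncomputable section

open Complex Set

namespace Summit.RiemannHypothesis.Cruxes.ExactFirstBand.Negative

open Summit.RiemannHypothesis.RiemannHypothesis.Theses.RuelleBand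
open Literature.NumberTheory.LFunctions

/-- Dropping `riemannZeta s = 0` ⇒ FALSE (sanity; witness `1/4 + i`). [folklore] -/
theorem exactFirstBand_false_without_zeta :
    ¬ ∀ s : ℂ, 0 < s.re → s.re < 1 → s.re = 1 / 2 ∨ s.im = 0 := by
  intro h
  rcases h ⟨1 / 4, 1⟩ (by norm_num) (by norm_num) with h | h <;> norm_num at h

/-- Dropping `0 < s.re` gives an EQUIVALENT statement: the zeros with `re s ≤ 0` are the trivial zeros
`-2(n+1)` (tree `riemannZeta_eq_zero_iff_of_re_nonpos`, functional equation), which are REAL — the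
"real exceptional resonances" clause absorbs them. `0 < s.re` is decoration. [cite: Titchmarsh1986, §2.4 and §2.12] -/
theorem exactFirstBand_iff_without_pos :
    ExactFirstBand ↔ ∀ s : ℂ, riemannZeta s = 0 → s.re < 1 → s.re = 1 / 2 ∨ s.im = 0 := by
  refine ⟨fun h s hs h1 => ?_, fun h s hs _ h1 => h s hs h1⟩
  rcases lt_or_ge 0 s.re with h0 | h0
  · exact h s hs h0 h1
  · obtain ⟨n, rfl⟩ := (riemannZeta_eq_zero_iff_of_re_nonpos h0).1 hs
    exact Or.inr (by simp)

/-- Dropping `s.re < 1` gives an EQUIVALENT statement (no zeros on `re s ≥ 1`, Mathlib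
`riemannZeta_ne_zero_of_one_le_re` — Hadamard–de la Vallée Poussin, via the EULER PRODUCT). `s.re < 1` is
decoration. [folklore] -/
theorem exactFirstBand_iff_without_ltOne :
    ExactFirstBand ↔ ∀ s : ℂ, riemannZeta s = 0 → 0 < s.re → s.re = 1 / 2 ∨ s.im = 0 := by
  refine ⟨fun h s hs h0 => ?_, fun h s hs h0 _ => h s hs h0⟩
  rcases lt_or_ge s.re 1 with h1 | h1
  · exact h s hs h0 h1
  · exact absurd hs (riemannZeta_ne_zero_of_one_le_re h1)

/-- X with BOTH strip conditions dropped — "every zero of (Mathlib's) `riemannZeta` is critical or real" — is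
again EQUIVALENT to X (and to RH): the cleanest side-condition-free form of the crux (Mathlib's junk value at
`s = 1` is irrelevant: `1` is real). [folklore] -/
theorem exactFirstBand_iff_allZeros :
    ExactFirstBand ↔ ∀ s : ℂ, riemannZeta s = 0 → s.re = 1 / 2 ∨ s.im = 0 := by
  refine ⟨fun h s hs => ?_, fun h s hs _ _ => h s hs⟩
  rcases lt_or_ge 0 s.re with h0 | h0
  · rcases lt_or_ge s.re 1 with h1 | h1
    · exact h s hs h0 h1
    · exact absurd hs (riemannZeta_ne_zero_of_one_le_re h1)
  · obtain ⟨n, rfl⟩ := (riemannZeta_eq_zero_iff_of_re_nonpos h0).1 hs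
    exact Or.inr (by simp)

/-- X ⟺ "every zero with `re s > 1/2` is real" (reflect the left half of the strip by `s ↦ 1 - s`, tree
`GeneralizedRH.riemannZeta_one_sub_eq_zero`; no zeros on `re s ≥ 1`). [folklore] -/
theorem exactFirstBand_iff_rightZerosReal :
    ExactFirstBand ↔ ∀ s : ℂ, riemannZeta s = 0 → 1 / 2 < s.re → s.im = 0 := by
  constructor
  · intro hX s hs h
    rcases lt_or_ge s.re 1 with h1 | h1
    · rcases hX s hs (by linarith) h1 with h' | h'
      · exact absurd h' (by intro h''; linarith)
      · exact h'
    · exact absurd hs (riemannZeta_ne_zero_of_one_le_re h1)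
  · intro h s hs h0 h1
    rcases lt_trichotomy s.re (1 / 2) with hlt | heq | hgt
    · have h1s := h (1 - s) (GeneralizedRH.riemannZeta_one_sub_eq_zero hs h0 h1)
        (by simp only [sub_re, one_re]; linarith)
      exact Or.inr (by simpa [sub_im] using h1s)
    · exact Or.inl heq
    · exact Or.inr (h s hs hgt)

/-- A zero ON the critical line with non-zero ordinate exists (Hardy 1914; tree
`hardy_infinite_zeros_on_critical_line_holds`, proved). [cite: Hardy1914, C. R. Acad. Sci. Paris 158] -/
theorem exists_zero_on_line : ∃ t : ℝ, t ≠ 0 ∧ riemannZeta (1 / 2 + t * I) = 0 := by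
  obtain ⟨t, ht, ht0⟩ := hardy_infinite_zeros_on_critical_line_holds.exists_notMem_finset {0}
  exact ⟨t, by simpa using ht0, ht⟩

/-- Dropping the disjunct `s.re = 1 / 2` ("all strip zeros are real") is FALSE by Hardy's theorem.
[cite: Hardy1914, C. R. Acad. Sci. Paris 158] -/
theorem not_allStripZerosReal : ¬ ∀ s : ℂ, riemannZeta s = 0 → 0 < s.re → s.re < 1 → s.im = 0 := by
  intro h
  obtain ⟨t, ht0, ht⟩ := exists_zero_on_line
  have := h _ ht (by norm_num) (by norm_num)
  exact ht0 (by simpa using this)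

/-- TIGHTNESS OF THE ABSCISSA: X with `1/2` replaced by any `σ₀ ≠ 1/2` is FALSE (a Hardy zero is neither on
`re s = σ₀` nor real). [cite: Hardy1914, C. R. Acad. Sci. Paris 158] -/
theorem not_exactFirstBand_at_other_line {σ₀ : ℝ} (hσ : σ₀ ≠ 1 / 2) :
    ¬ ∀ s : ℂ, riemannZeta s = 0 → 0 < s.re → s.re < 1 → s.re = σ₀ ∨ s.im = 0 := by
  intro h
  obtain ⟨t, ht0, ht⟩ := exists_zero_on_line
  rcases h _ ht (by norm_num) (by norm_num) with h' | h'
  · exact hσ (by norm_num at h'; exact h'.symm)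
  · exact ht0 (by simpa using h')

end Summit.RiemannHypothesis.Cruxes.ExactFirstBand.Negative

end
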